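import Summits.CriticalPhenomena.PercolationContinuityZ3.Theorems.PercNearOneGluingNoHeavyLowerTailSahiCombSymmetry
import Summits.CriticalPhenomena.PercolationContinuityZ3.Theorems.PercNearOneGluingNoHeavyLowerTailSahiCombPrivate

/-!
# The comb (tensor-Bernstein) hierarchy for Sahi's `E_k`, XVI: coefficient lines along a PRIVATE axis are two-term binomial — the typed
# shape laws ENDMIN / ORDER-1 hold along every private axis, for every `k`, given nonnegativity of the two section coefficients

Support file of the one-cut programme (crux `NoHeavyLowerTail`, stmt-CriticalPhenomena-4575; cell `prim-masterthm`, seat P5; report §8.2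
"multiplicity reduction").  prim-masterthm P3 (gen 3) proved that `E_k(μ_p; 1_U)` is AFFINE in `p_e` when the coordinate `e` is PRIVATE to one
member `U_i` (`sahiE_ind_private_eq`, `…SahiCombPrivate`).  At the level of THE comb coefficients (`SahiComb.combCoeff`, uniqueness
`SahiComb.bern_coeff_unique`) this says that every coefficient line along `e` is the degree elevation of a degree-`1` line:

* `SahiComb.ind_insert_of_not_affects` — an increasing event not affected by `e` ignores `e`;
* **`SahiComb.combLine_private_eq`** — if `e` affects no member but `U_i` then, for `t ≤ k` and every profile,
  `c_t = C(k−1, t)·A₀ + (C(k, t) − C(k−1, t))·A₁` (`= C(k−1,t)A₀ + C(k−1,t−1)A₁`), where `A_b` is the `t = 0` coefficient of the section family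
  `U[i ↦ U_i^{e←b}]` — the coefficients of `(A₀ + A₁x)(1+x)^{k−1}`;
* **`SahiComb.combEndMin_private`**, **`SahiComb.combOrderOne_private`** — hence, whenever `A₀, A₁ ≥ 0` (e.g. under (M⁺-k) for the two section
  families — inside the coordinate induction of `…SahiCombShape` this is the induction hypothesis), the line satisfies ENDMIN and (for `k ≥ 2`)
  ORDER-1: the conjectures `CombEndMin k` / `CombOrderOne k` have content only on axes shared by at least two members.
Everything here is proved; axioms standard. [this work]
-/

noncomputable section

open scoped Classical

namespace Summit.CriticalPhenomena.PercolationContinuityZ3.Theorems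

open Finset Function
open Literature.Combinatorics.Sahi2008
open Literature.Probability.LatticeModels.Kahn2022 (Affects)
open Literature.Probability.Percolation.DecisionTree (ind ind_of_mem ind_of_not_mem ind_nonneg)
open SahiComb SahiCombPrivate

namespace SahiComb

variable {ι : Type} [Fintype ι]

omit [Fintype ι] in
/-- An increasing event not affected by `e` ignores `e`. [folklore] -/
theorem ind_insert_of_not_affects {X : Set (Set ι)} (hX : IsUpperSet X) {e : ι} (he : ¬ Affects X e) (ω : Set ι) :
    ind X (insert e ω) = ind X ω := by
  by_cases hω : ω ∈ X
  · rw [ind_of_mem hω, ind_of_mem (hX (Set.subset_insert e ω) hω)]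
  · have h1 : insert e ω ∉ X := fun h => he ⟨ω, hω, h⟩
    rw [ind_of_not_mem hω, ind_of_not_mem h1]

/-- `Σ_{t ≤ k} C(k,t) x^t (1−x)^{k−t} = 1`. [folklore] -/
theorem sum_choose_mul_pow_mul_pow (k : ℕ) (x : ℝ) :
    ∑ t ∈ range (k + 1), (k.choose t : ℝ) * (x ^ t * (1 - x) ^ (k - t)) = 1 := by
  calc ∑ t ∈ range (k + 1), (k.choose t : ℝ) * (x ^ t * (1 - x) ^ (k - t))
      = ∑ t ∈ range (k + 1), x ^ t * (1 - x) ^ (k - t) * (k.choose t : ℝ) := sum_congr rfl fun t _ => by ring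
    _ = (x + (1 - x)) ^ k := (add_pow x (1 - x) k).symm
    _ = 1 := by rw [add_sub_cancel, one_pow]

/-- `Σ_{t ≤ k} C(k−1,t) x^t (1−x)^{k−t} = 1 − x` for `k ≥ 1`. [folklore] -/
theorem sum_choose_pred_mul_pow_mul_pow {k : ℕ} (hk : 1 ≤ k) (x : ℝ) :
    ∑ t ∈ range (k + 1), ((k - 1).choose t : ℝ) * (x ^ t * (1 - x) ^ (k - t)) = 1 - x := by
  obtain ⟨k', rfl⟩ : ∃ k', k = k' + 1 := ⟨k - 1, by omega⟩
  rw [sum_range_succ, Nat.add_sub_cancel, Nat.choose_succ_self, Nat.cast_zero, zero_mul, add_zero]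
  have h := sum_choose_mul_pow_mul_pow k' x
  calc ∑ t ∈ range (k' + 1), (k'.choose t : ℝ) * (x ^ t * (1 - x) ^ (k' + 1 - t))
      = (1 - x) * ∑ t ∈ range (k' + 1), (k'.choose t : ℝ) * (x ^ t * (1 - x) ^ (k' - t)) := by
        rw [mul_sum]
        refine sum_congr rfl fun t ht => ?_
        have htk : t ≤ k' := Nat.lt_succ_iff.1 (mem_range.1 ht)
        rw [show k' + 1 - t = (k' - t) + 1 by omega, pow_succ]
        ring
    _ = 1 - x := by rw [h, mul_one]

/-- **Coefficient lines along a private axis are two-term binomial.**  If no member other than `U_i` is affected by `e`, then for every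
profile `j` with `j[e ↦ 0]` in the box and every `t ≤ k` (`k ≥ 1`):
`c_t = C(k−1,t)·A₀ + (C(k,t) − C(k−1,t))·A₁`, `A_b = combLine k (U[i ↦ U_i^{e←b}]) e j 0`. [this work] -/
theorem combLine_private_eq {n : ℕ} (U : Fin (n + 1) → Set (Set ι)) (hU : ∀ i', IsUpperSet (U i')) (i : Fin (n + 1)) (e : ι)
    (hpriv : ∀ i', i' ≠ i → ¬ Affects (U i') e) (j : ι → ℕ) (hj : update j e 0 ∈ box (fun _ : ι => n + 1)) {t : ℕ}
    (ht : t ≤ n + 1) :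
    combLine (n + 1) U e j t =
      ((n.choose t : ℕ) : ℝ) * combLine (n + 1) (update U i (secAt e false (U i))) e j 0 +
        (((n + 1).choose t : ℕ) - (n.choose t : ℕ) : ℝ) * combLine (n + 1) (update U i (secAt e true (U i))) e j 0 := by
  -- the two section families ignore `e`
  have hign : ∀ (b : Bool) (i' : Fin (n + 1)) (ω : Set ι),
      ind (update U i (secAt e b (U i)) i') (insert e ω) = ind (update U i (secAt e b (U i)) i') ω := by
    intro b i' ω
    by_cases hi : i' = i
    · subst hi; rw [update_self]; exact ind_secAt_insert e b (U i') ω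
    · rw [update_of_ne hi]; exact ind_insert_of_not_affects (hU i') (hpriv i' hi) ω
  -- the candidate coefficient family
  let A : Bool → (ι → ℕ) → ℝ := fun b j' => combCoeff (n + 1) (fun i' => ind (update U i (secAt e b (U i)) i')) (update j' e 0)
  let N : (ι → ℕ) → ℝ := fun j' =>
    ((n.choose (j' e) : ℕ) : ℝ) * A false j' + (((n + 1).choose (j' e) : ℕ) - (n.choose (j' e) : ℕ) : ℝ) * A true j'
  -- representation of `E_k(μ_p; 1_U)` by `N`
  have hrep : ∀ p : ι → unitInterval,
      ∑ j' ∈ box (fun _ : ι => n + 1), combCoeff (n + 1) (fun i' => ind (U i')) j' * bern (fun _ => n + 1) j' p =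
        ∑ j' ∈ box (fun _ : ι => n + 1), N j' * bern (fun _ => n + 1) j' p := by
    intro p
    rw [← sahiE_bernoulliWeight_eq_sum_combCoeff, sahiE_ind_private_eq p U hU i e hpriv,
      sahiE_bernoulliWeight_eq_sum_combCoeff p (n + 1), sahiE_bernoulliWeight_eq_sum_combCoeff p (n + 1)]
    -- split every box sum over the `e`-coordinate
    rw [sum_box_eq_sum_fiber_update (fun _ : ι => n + 1) e, sum_box_eq_sum_fiber_update (fun _ : ι => n + 1) e,
      sum_box_eq_sum_fiber_update (fun _ : ι => n + 1) e (fun j' => N j' * bern (fun _ => n + 1) j' p)]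
    -- lines of the section families are binomial; basis functions factor
    have hb : ∀ (s : ℕ) (j' : ι → ℕ), j' ∈ box (update (fun _ : ι => n + 1) e 0) →
        bern (fun _ : ι => n + 1) (update j' e s) p =
          ((p e : ℝ) ^ s * (1 - (p e : ℝ)) ^ (n + 1 - s)) * bern (update (fun _ : ι => n + 1) e 0) j' p := by
      intro s j' hj'
      have hje : j' e = 0 := Nat.le_zero.1 (by simpa using mem_box.1 hj' e)
      have h := bern_update_param (fun _ : ι => n + 1) (update j' e s) p e (p e)
      rw [update_eq_self, update_self, update_idem, ← hje, update_eq_self, hje] at h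
      exact h
    have hsec : ∀ (b : Bool) (s : ℕ) (j' : ι → ℕ),
        combCoeff (n + 1) (fun i' => ind (update U i (secAt e b (U i)) i')) (update j' e s) = ((n + 1).choose s : ℝ) * A b j' :=
      fun b s j' => combCoeff_update_of_ignores (hign b) j' s
    -- rewrite both sides as double sums Σ_s Σ_{j'} and compare termwise in `j'`
    rw [mul_sum, mul_sum, ← sum_add_distrib]
    have lhs : ∀ s ∈ range (n + 1 + 1), ((1 - (p e : ℝ)) * ∑ j' ∈ box (update (fun _ : ι => n + 1) e 0),
          combCoeff (n + 1) (fun i' => ind (update U i (secAt e false (U i)) i')) (update j' e s) *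
            bern (fun _ => n + 1) (update j' e s) p +
        (p e : ℝ) * ∑ j' ∈ box (update (fun _ : ι => n + 1) e 0),
          combCoeff (n + 1) (fun i' => ind (update U i (secAt e true (U i)) i')) (update j' e s) *
            bern (fun _ => n + 1) (update j' e s) p) =
        ∑ j' ∈ box (update (fun _ : ι => n + 1) e 0),
          ((((n + 1).choose s : ℕ) : ℝ) * ((p e : ℝ) ^ s * (1 - (p e : ℝ)) ^ (n + 1 - s))) *
            (((1 - (p e : ℝ)) * A false j' + (p e : ℝ) * A true j') * bern (update (fun _ : ι => n + 1) e 0) j' p) := by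
      intro s _
      rw [mul_sum, mul_sum, ← sum_add_distrib]
      refine sum_congr rfl fun j' hj' => ?_
      rw [hsec false, hsec true, hb s j' hj']
      ring
    have rhs : ∀ s ∈ range (n + 1 + 1),
        ∑ j' ∈ box (update (fun _ : ι => n + 1) e 0), N (update j' e s) * bern (fun _ => n + 1) (update j' e s) p =
        ∑ j' ∈ box (update (fun _ : ι => n + 1) e 0),
          ((((n.choose s : ℕ) : ℝ) * ((p e : ℝ) ^ s * (1 - (p e : ℝ)) ^ (n + 1 - s))) * A false j' +
            ((((n + 1).choose s : ℕ) - (n.choose s : ℕ) : ℝ) * ((p e : ℝ) ^ s * (1 - (p e : ℝ)) ^ (n + 1 - s))) * A true j') *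
            bern (update (fun _ : ι => n + 1) e 0) j' p := by
      intro s _
      refine sum_congr rfl fun j' hj' => ?_
      have hje : j' e = 0 := Nat.le_zero.1 (by simpa using mem_box.1 hj' e)
      simp only [N, A, update_self, update_idem]
      rw [hb s j' hj', ← hje, update_eq_self]
      ring
    rw [sum_congr rfl lhs, sum_congr rfl rhs, sum_comm, sum_comm (s := range (n + 1 + 1))]
    refine sum_congr rfl fun j' _ => ?_
    -- the three binomial sums in `p_e`
    have h1 := sum_choose_mul_pow_mul_pow (n + 1) (p e : ℝ)
    have h2 := sum_choose_pred_mul_pow_mul_pow (show 1 ≤ n + 1 by omega) (p e : ℝ)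
    rw [Nat.add_sub_cancel] at h2
    have h3 : ∑ s ∈ range (n + 1 + 1), ((((n + 1).choose s : ℕ) - (n.choose s : ℕ) : ℝ) *
        ((p e : ℝ) ^ s * (1 - (p e : ℝ)) ^ (n + 1 - s))) = (p e : ℝ) := by
      have : ∑ s ∈ range (n + 1 + 1), ((((n + 1).choose s : ℕ) - (n.choose s : ℕ) : ℝ) *
          ((p e : ℝ) ^ s * (1 - (p e : ℝ)) ^ (n + 1 - s))) =
          ∑ s ∈ range (n + 1 + 1), (((n + 1).choose s : ℕ) : ℝ) * ((p e : ℝ) ^ s * (1 - (p e : ℝ)) ^ (n + 1 - s)) -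
            ∑ s ∈ range (n + 1 + 1), ((n.choose s : ℕ) : ℝ) * ((p e : ℝ) ^ s * (1 - (p e : ℝ)) ^ (n + 1 - s)) := by
        rw [← sum_sub_distrib]; exact sum_congr rfl fun s _ => by ring
      rw [this, h2]
      have h1' : ∑ s ∈ range (n + 1 + 1), (((n + 1).choose s : ℕ) : ℝ) * ((p e : ℝ) ^ s * (1 - (p e : ℝ)) ^ (n + 1 - s)) = 1 := by
        exact_mod_cast h1
      rw [h1']; ring
    have eL : ∑ s ∈ range (n + 1 + 1), ((((n + 1).choose s : ℕ) : ℝ) * ((p e : ℝ) ^ s * (1 - (p e : ℝ)) ^ (n + 1 - s))) *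
        (((1 - (p e : ℝ)) * A false j' + (p e : ℝ) * A true j') * bern (update (fun _ : ι => n + 1) e 0) j' p) =
        ((1 - (p e : ℝ)) * A false j' + (p e : ℝ) * A true j') * bern (update (fun _ : ι => n + 1) e 0) j' p := by
      rw [← sum_mul]
      have h1' : ∑ s ∈ range (n + 1 + 1), (((n + 1).choose s : ℕ) : ℝ) * ((p e : ℝ) ^ s * (1 - (p e : ℝ)) ^ (n + 1 - s)) = 1 := by
        exact_mod_cast h1
      rw [h1', one_mul]
    have eR : ∑ s ∈ range (n + 1 + 1),
        ((((n.choose s : ℕ) : ℝ) * ((p e : ℝ) ^ s * (1 - (p e : ℝ)) ^ (n + 1 - s))) * A false j' +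
          ((((n + 1).choose s : ℕ) - (n.choose s : ℕ) : ℝ) * ((p e : ℝ) ^ s * (1 - (p e : ℝ)) ^ (n + 1 - s))) * A true j') *
          bern (update (fun _ : ι => n + 1) e 0) j' p =
        ((1 - (p e : ℝ)) * A false j' + (p e : ℝ) * A true j') * bern (update (fun _ : ι => n + 1) e 0) j' p := by
      rw [← sum_mul, sum_add_distrib, ← sum_mul, ← sum_mul, h2, h3]
    rw [eL, eR]
  -- uniqueness at the profile `j[e ↦ t]`
  have hjt : update j e t ∈ box (fun _ : ι => n + 1) := by
    rw [mem_box]; intro e'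
    by_cases he : e' = e
    · subst he; simpa using ht
    · rw [update_of_ne he]; have := mem_box.1 hj e'; rwa [update_of_ne he] at this
  have hu := bern_coeff_unique hrep (update j e t) hjt
  unfold combLine
  rw [hu]
  simp only [N, A, update_self, update_idem]

/-- **ENDMIN along a private axis**: with the notation of `combLine_private_eq`, if the two section coefficients `A₀, A₁` are `≥ 0`
then `min(c_0, c_k) ≤ c_t` for `t ≤ k` (indeed `c_0 = A₀`, `c_k = A₁`, and `c_t ≥ A₀ + A₁` in between). [this work] -/
theorem combEndMin_private {n : ℕ} (U : Fin (n + 1) → Set (Set ι)) (hU : ∀ i', IsUpperSet (U i')) (i : Fin (n + 1)) (e : ι)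
    (hpriv : ∀ i', i' ≠ i → ¬ Affects (U i') e) (j : ι → ℕ)
    (h0 : 0 ≤ combLine (n + 1) (update U i (secAt e false (U i))) e j 0)
    (h1 : 0 ≤ combLine (n + 1) (update U i (secAt e true (U i))) e j 0) {t : ℕ} (ht : t ≤ n + 1) :
    min (combLine (n + 1) U e j 0) (combLine (n + 1) U e j (n + 1)) ≤ combLine (n + 1) U e j t := by
  by_cases hj : update j e 0 ∈ box (fun _ : ι => n + 1)
  · rw [combLine_private_eq U hU i e hpriv j hj (Nat.zero_le _), combLine_private_eq U hU i e hpriv j hj le_rfl,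
      combLine_private_eq U hU i e hpriv j hj ht]
    simp only [Nat.choose_zero_right, Nat.choose_succ_self, Nat.choose_self, Nat.cast_one, Nat.cast_zero, sub_self, one_mul,
      zero_mul, add_zero, sub_zero, zero_add]
    -- `min A₀ A₁ ≤ C(n,t) A₀ + (C(n+1,t) − C(n,t)) A₁`
    have hc2 : (0 : ℝ) ≤ (((n + 1).choose t : ℕ) : ℝ) - ((n.choose t : ℕ) : ℝ) := by
      have hle : n.choose t ≤ (n + 1).choose t := Nat.choose_mono t (Nat.le_succ n)
      exact sub_nonneg.2 (by exact_mod_cast hle)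
    rcases Nat.lt_or_ge t (n + 1) with htl | htl
    · -- `t ≤ n`: `C(n,t) ≥ 1`
      have hc1' : (1 : ℝ) ≤ ((n.choose t : ℕ) : ℝ) := by exact_mod_cast Nat.choose_pos (by omega)
      calc min _ _ ≤ combLine (n + 1) (update U i (secAt e false (U i))) e j 0 := min_le_left _ _
        _ ≤ _ := by nlinarith
    · -- `t = n + 1`
      have htn : t = n + 1 := le_antisymm ht htl
      subst htn
      simp only [Nat.choose_succ_self, Nat.choose_self, Nat.cast_zero, Nat.cast_one, zero_mul, zero_add, sub_zero, one_mul]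
      exact min_le_right _ _
  · have h0' : ∀ s, combLine (n + 1) U e j s = 0 := combLine_eq_zero_of_not_mem_box U e hj
    simp only [h0', min_self, le_refl]

/-- **ORDER-1 along a private axis** (`k = n + 1 ≥ 2`): `c_0 ≤ c_1` and `c_k ≤ c_{k−1}` when the two section coefficients are `≥ 0`.
[this work] -/
theorem combOrderOne_private {n : ℕ} (hn : 1 ≤ n) (U : Fin (n + 1) → Set (Set ι)) (hU : ∀ i', IsUpperSet (U i')) (i : Fin (n + 1))
    (e : ι) (hpriv : ∀ i', i' ≠ i → ¬ Affects (U i') e) (j : ι → ℕ)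
    (h0 : 0 ≤ combLine (n + 1) (update U i (secAt e false (U i))) e j 0)
    (h1 : 0 ≤ combLine (n + 1) (update U i (secAt e true (U i))) e j 0) :
    combLine (n + 1) U e j 0 ≤ combLine (n + 1) U e j 1 ∧
      combLine (n + 1) U e j (n + 1) ≤ combLine (n + 1) U e j (n + 1 - 1) := by
  by_cases hj : update j e 0 ∈ box (fun _ : ι => n + 1)
  · rw [combLine_private_eq U hU i e hpriv j hj (Nat.zero_le _), combLine_private_eq U hU i e hpriv j hj (by omega : 1 ≤ n + 1),
      combLine_private_eq U hU i e hpriv j hj le_rfl, combLine_private_eq U hU i e hpriv j hj (Nat.sub_le _ _)]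
    rw [show n + 1 - 1 = n from rfl]
    simp only [Nat.choose_zero_right, Nat.choose_one_right, Nat.choose_succ_self, Nat.choose_self, Nat.choose_succ_self_right,
      Nat.cast_one, Nat.cast_zero, Nat.cast_add, sub_self, one_mul, zero_mul, add_zero, sub_zero, zero_add]
    have hnn : (1 : ℝ) ≤ (n : ℝ) := by exact_mod_cast hn
    constructor <;> nlinarith
  · have h0' : ∀ s, combLine (n + 1) U e j s = 0 := combLine_eq_zero_of_not_mem_box U e hj
    simp only [h0', le_refl, and_self]

end SahiComb

end Summit.CriticalPhenomena.PercolationContinuityZ3.Theorems
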